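import Summits.KontsevichZagierPeriods.KontsevichZagierPeriods.Theorems.LinRedNormalFormArrangementNormalFormStubRebaseSimplePosOneFibreApex

/-!
# Stub `stub_rebaseSimplePosOne`, residual hypothesis `Hpar` (crux `ArrangementNormalForm`,
line `janus-bands`, v6.2) — sub-part `ParThick`

The residual hypothesis `Hpar` of `RebasePos.good_above_of_residual` concerns one lettered fibre
`t` (letter `0`) over a base `(x', y)` of dimension `B + 1` with affine bounds `0 < u < v` that
are PARALLEL in `y` (`u_y = v_y ≠ 0`); the width `w = v − u` is then a `y`-free affine form of
`x'`. This file closes the THICK regime and provides the two Janus tools of the parallel case,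
uniformly in the silent coordinates `x'` (rules 1a and 2 of the Kontsevich–Zagier calculus):
* `RebasePos.good_parUp` — Janus extension of the upper bound up to ANY `y`-free affine level
  `K ≥ v` with `λ (K − v) ≤ v − u` on the base cell (`λ > 0` rational): the upper wedge
  `{v < t < K}` is dominated with constant `1` (`RebasePos.integrableOn_wedge_hi`, the map
  `t ↦ v − λ (K − t)`), and both pieces `{u < t < K}`, `{v < t < K}` have the upper bound `K`
  parallel to the letter, hence land by ONE affine pull-back each (`RebasePos.good_product`);
* `RebasePos.good_parDown` — Janus extension of the lower bound down to a `y`-free level `K` with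
  `0 < K ≤ u`, `λ (u − K) ≤ v − u` and `v ≤ C K` on the base cell (lower wedge by
  `RebasePos.integrableOn_wedge_near`);
* `RebasePos.good_parThick` — THICK bands (`v − u ≥ δ > 0` on the base cell): `good_parUp` with a
  CONSTANT level `K ≥ sup v` (the base cell is bounded because the band is bounded with
  non-empty fibres) and `λ = δ'/(2K)`, `δ' ∈ ℚ ∩ (0, δ)`.
Registered as `rebaseSimplePos_par_thick` (the hypotheses of `Hpar` that are not needed — the
slopes of `u`, `v` — are dropped). The THIN regime (`inf w = 0`, e.g.
`[{0<x<1, 0<y<1, y+1<t<y+1+x}, 1/(x(x+1)(y+1)t)]`) is not dominated by any Janus extension to a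
`y`-free level and is treated separately.

References: M. Kontsevich, D. Zagier, *Periods* (2001), §1.2, rules (1a), (2).
-/

noncomputable section

open Set MeasureTheory MvPolynomial
open Literature.NumberTheory.Transcendental Literature.ModelTheory.ExponentialFields

namespace Summit.KontsevichZagierPeriods.ArrangementNormalForm.JanusBands

namespace RebasePos

open SeparatePos

section ParThick

variable {B m m' : ℕ} (L : Fin m → (Fin B → ℚ) × ℚ) (e : Fin m → ℕ) (ℓ₁ ℓ₂ : (Fin B → ℚ) × ℚ)
  (n₁ n₂ : ℕ)

/-- **Janus up to a `y`-free level with a dominated upper wedge.** One lettered fibre with letter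
`0` and affine bounds `0 < u < v` on the base cell, a `y`-free affine level `K ≥ v` with
`λ (K − v) ≤ v − u` on the base cell for a rational `λ > 0`: `[s]` is congruent modulo
`KZ.relations` to the subgroup generated by `GG B 2 1` (Janus extension of the upper bound up to
`K`, rule 1a; the upper wedge converges by `integrableOn_wedge_hi`; both pieces have the upper
bound `K` parallel to the letter and land by `good_product`, rule 2). -/
theorem good_parUp (s : KZ.IntegralRep (B + 1 + 1)) (M : Fin m' → (Fin (B + 1) → ℚ) × ℚ)
    (p : MvPolynomial (Fin B) ℚ) (u v K : (Fin (B + 1) → ℚ) × ℚ) (lam : ℚ) (h12 : n₁ = 0 ∨ n₂ = 0)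
    (hbd : Bornology.IsBounded s.domain)
    (hdom : s.domain = gDom B 1 m' M (fun _ => Sum.inr u) (fun _ => Sum.inr v))
    (hint : EqOn s.integrand (glit B 1 p L e ℓ₁ ℓ₂ n₁ n₂ (fun _ => some 0)) s.domain)
    (hK : K.1 (Fin.last B) = 0) (hlam : 0 < lam)
    (hcell : ∀ z : Fin (B + 1 + 1) → ℝ, (∀ j, 0 < affF B 1 (M j) z) →
      0 < affF B 1 u z ∧ affF B 1 u z < affF B 1 v z ∧ affF B 1 v z ≤ affF B 1 K z ∧
      (lam : ℝ) * (affF B 1 K z - affF B 1 v z) ≤ affF B 1 v z - affF B 1 u z) :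
    ∃ c ∈ AddSubgroup.closure (GGset B 2 1), KZ.of s - c ∈ KZ.relations := by
  -- the upper wedge converges
  have hWint : IntegrableOn (glit B 1 p L e ℓ₁ ℓ₂ n₁ n₂ (fun _ => some 0))
      (gDom B 1 m' M (fun _ => Sum.inr v) (fun _ => Sum.inr K)) :=
    integrableOn_wedge_hi s M p L e ℓ₁ ℓ₂ n₁ n₂ 0 u v K hdom hint lam hlam fun z hz => by
      obtain ⟨hu0, -, hvK, hlen⟩ := hcell z hz
      exact ⟨by rwa [affF_zero''], hvK, hlen⟩
  -- Janus extension of the upper bound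
  obtain ⟨sT, sW, hdT, hiT, hbdT, hdW, hiW, hbdW, hrel⟩ := janusExtendHi s M (fun _ => Sum.inr u)
    (fun _ => Sum.inr v) hdom L e p ℓ₁ ℓ₂ n₁ n₂ (fun _ => some 0) hint 0 v K rfl
    (fun z hz => (hcell z hz).2.2.1) (fun z hz => le_of_lt (hcell z hz.1).2.1)
    (by rw [update_fin_one, update_fin_one]; exact hWint)
    (by rw [update_fin_one]; exact isBounded_gDom_one M u v u K (hdom ▸ hbd) fun z hz => (hcell z hz).2.1)
  rw [update_fin_one] at hdT hdW
  rw [update_fin_one] at hdW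
  have hK0 : ∀ c : (Fin (B + 1) → ℚ) × ℚ, some (0 : (Fin (B + 1) → ℚ) × ℚ) = some c →
      K.1 (Fin.last B) = c.1 (Fin.last B) := fun c hc => by cases hc; simpa using hK
  refine good_of_janus hrel ?_ ?_
  · exact good_product (fun _ => some 0) (fun _ => u) (fun _ => K) sT M L e p ℓ₁ ℓ₂
      (fun _ => Sum.inr u) (fun _ => Sum.inr K) h12 hbdT hdT (by rw [hiT]; exact fun _ _ => rfl)
      (fun _ => rfl) (fun _ => rfl) fun _ c hc => Or.inr (hK0 c hc)
  · exact good_product (fun _ => some 0) (fun _ => v) (fun _ => K) sW M L e p ℓ₁ ℓ₂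
      (fun _ => Sum.inr v) (fun _ => Sum.inr K) h12 hbdW hdW (by rw [hiW]; exact fun _ _ => rfl)
      (fun _ => rfl) (fun _ => rfl) fun _ c hc => Or.inr (hK0 c hc)

/-- **Janus down to a `y`-free level with a dominated lower wedge.** One lettered fibre with
letter `0` and affine bounds `u < v`, a `y`-free affine level `K` with, on the base cell,
`0 < K ≤ u`, `λ (u − K) ≤ v − u` (`λ > 0` rational) and `v ≤ C K`: `[s]` is congruent modulo
`KZ.relations` to the subgroup generated by `GG B 2 1` (Janus extension of the lower bound down to
`K`, rule 1a; the lower wedge converges by `integrableOn_wedge_near`; both pieces have the lower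
bound `K` parallel to the letter and land by `good_product`, rule 2). -/
theorem good_parDown (s : KZ.IntegralRep (B + 1 + 1)) (M : Fin m' → (Fin (B + 1) → ℚ) × ℚ)
    (p : MvPolynomial (Fin B) ℚ) (u v K : (Fin (B + 1) → ℚ) × ℚ) (lam : ℚ) (C : ℝ)
    (h12 : n₁ = 0 ∨ n₂ = 0) (hbd : Bornology.IsBounded s.domain)
    (hdom : s.domain = gDom B 1 m' M (fun _ => Sum.inr u) (fun _ => Sum.inr v))
    (hint : EqOn s.integrand (glit B 1 p L e ℓ₁ ℓ₂ n₁ n₂ (fun _ => some 0)) s.domain)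
    (hK : K.1 (Fin.last B) = 0) (hlam : 0 < lam)
    (hcell : ∀ z : Fin (B + 1 + 1) → ℝ, (∀ j, 0 < affF B 1 (M j) z) →
      0 < affF B 1 K z ∧ affF B 1 K z ≤ affF B 1 u z ∧ affF B 1 u z < affF B 1 v z ∧
      (lam : ℝ) * (affF B 1 u z - affF B 1 K z) ≤ affF B 1 v z - affF B 1 u z ∧
      affF B 1 v z ≤ C * affF B 1 K z) :
    ∃ c ∈ AddSubgroup.closure (GGset B 2 1), KZ.of s - c ∈ KZ.relations := by
  -- the lower wedge converges (near regime)
  have hWint : IntegrableOn (glit B 1 p L e ℓ₁ ℓ₂ n₁ n₂ (fun _ => some 0))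
      (gDom B 1 m' M (fun _ => Sum.inr K) (fun _ => Sum.inr u)) :=
    integrableOn_wedge_near s M p L e ℓ₁ ℓ₂ n₁ n₂ 0 u v K hdom hint lam C hlam fun z hz => by
      obtain ⟨hK0, hKu, -, hlen, hvC⟩ := hcell z hz
      exact ⟨by rwa [affF_zero''], hKu, hlen, by rwa [affF_zero'', sub_zero, sub_zero]⟩
  obtain ⟨sT, sW, hdT, hiT, hbdT, hdW, hiW, hbdW, hrel⟩ := janusExtendLo s M (fun _ => Sum.inr u)
    (fun _ => Sum.inr v) hdom L e p ℓ₁ ℓ₂ n₁ n₂ (fun _ => some 0) hint 0 u K rfl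
    (fun z hz => (hcell z hz).2.1) (fun z hz => le_of_lt (hcell z hz.1).2.2.1)
    (by rw [update_fin_one, update_fin_one]; exact hWint)
    (by rw [update_fin_one]; exact isBounded_gDom_one M u v K v (hdom ▸ hbd) fun z hz => (hcell z hz).2.2.1)
  rw [update_fin_one] at hdT hdW
  rw [update_fin_one] at hdW
  have hK0 : ∀ c : (Fin (B + 1) → ℚ) × ℚ, some (0 : (Fin (B + 1) → ℚ) × ℚ) = some c →
      K.1 (Fin.last B) = c.1 (Fin.last B) := fun c hc => by cases hc; simpa using hK
  refine good_of_janus hrel ?_ ?_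
  · exact good_product (fun _ => some 0) (fun _ => K) (fun _ => v) sT M L e p ℓ₁ ℓ₂
      (fun _ => Sum.inr K) (fun _ => Sum.inr v) h12 hbdT hdT (by rw [hiT]; exact fun _ _ => rfl)
      (fun _ => rfl) (fun _ => rfl) fun _ c hc => Or.inl (hK0 c hc)
  · exact good_product (fun _ => some 0) (fun _ => K) (fun _ => u) sW M L e p ℓ₁ ℓ₂
      (fun _ => Sum.inr K) (fun _ => Sum.inr u) h12 hbdW hdW (by rw [hiW]; exact fun _ _ => rfl)
      (fun _ => rfl) (fun _ => rfl) fun _ c hc => Or.inl (hK0 c hc)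

/-- The base coordinates are bounded on the base cell of a bounded band with non-empty fibres. -/
theorem abs_base_le (M : Fin m' → (Fin (B + 1) → ℚ) × ℚ) (u v : (Fin (B + 1) → ℚ) × ℚ)
    (hbd : Bornology.IsBounded (gDom B 1 m' M (fun _ => Sum.inr u) (fun _ => Sum.inr v)))
    (hne : ∀ z : Fin (B + 1 + 1) → ℝ, (∀ j, 0 < affF B 1 (M j) z) → affF B 1 u z < affF B 1 v z) :
    ∃ R : ℝ, 0 < R ∧ ∀ z : Fin (B + 1 + 1) → ℝ, (∀ j, 0 < affF B 1 (M j) z) →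
      ∀ j : Fin (B + 1), |z (Fin.castAdd 1 j)| ≤ R := by
  obtain ⟨R, hR0, hR⟩ := hbd.exists_pos_norm_le
  refine ⟨R, hR0, fun z hz j => ?_⟩
  -- move the fibre coordinate into the band
  set z' : Fin (B + 1 + 1) → ℝ :=
    Function.update z (Fin.natAdd (B + 1) 0) ((affF B 1 u z + affF B 1 v z) / 2) with hz'
  have hbase : ∀ j : Fin (B + 1), z' (Fin.castAdd 1 j) = z (Fin.castAdd 1 j) := fun j => by
    rw [hz', Function.update_of_ne]
    intro h
    have := congrArg Fin.val h
    simp at this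
    omega
  have haff : ∀ d, affF B 1 d z' = affF B 1 d z := fun d => by simp [affF, hbase]
  have hz'D : z' ∈ gDom B 1 m' M (fun _ => Sum.inr u) (fun _ => Sum.inr v) := by
    rw [mem_gDom_one]
    simp only [haff]
    have hlt := hne z hz
    refine ⟨hz, ?_, ?_⟩ <;> rw [hz', Function.update_self] <;> linarith
  have h := norm_le_pi_norm z' (Fin.castAdd 1 j)
  rw [Real.norm_eq_abs, hbase] at h
  exact h.trans (hR z' hz'D)

/-- **Thick bands.** One lettered fibre with letter `0` and affine bounds `0 < u < v` on the base
cell whose width is bounded below (`v − u ≥ δ > 0` on the base cell): `[s]` is congruent modulo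
`KZ.relations` to the subgroup generated by `GG B 2 1` — `good_parUp` with a constant level
`K ≥ sup v` and `λ = δ'/(2K)`. This is the THICK regime of the residual hypothesis `Hpar`
(parallel transverse bounds have a `y`-free width `w(x')`, thick when `inf w > 0`). -/
theorem good_parThick (s : KZ.IntegralRep (B + 1 + 1)) (M : Fin m' → (Fin (B + 1) → ℚ) × ℚ)
    (p : MvPolynomial (Fin B) ℚ) (u v : (Fin (B + 1) → ℚ) × ℚ) (h12 : n₁ = 0 ∨ n₂ = 0)
    (hbd : Bornology.IsBounded s.domain)
    (hdom : s.domain = gDom B 1 m' M (fun _ => Sum.inr u) (fun _ => Sum.inr v))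
    (hint : EqOn s.integrand (glit B 1 p L e ℓ₁ ℓ₂ n₁ n₂ (fun _ => some 0)) s.domain)
    (hcell : ∀ z : Fin (B + 1 + 1) → ℝ, (∀ j, 0 < affF B 1 (M j) z) →
      0 < affF B 1 u z ∧ affF B 1 u z < affF B 1 v z)
    (hδ : ∃ δ : ℝ, 0 < δ ∧ ∀ z : Fin (B + 1 + 1) → ℝ, (∀ j, 0 < affF B 1 (M j) z) →
      δ ≤ affF B 1 v z - affF B 1 u z) :
    ∃ c ∈ AddSubgroup.closure (GGset B 2 1), KZ.of s - c ∈ KZ.relations := by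
  obtain ⟨δ, hδ0, hδ⟩ := hδ
  -- a bound for the base coordinates on the cell, hence for `v`
  obtain ⟨R, -, hRz⟩ := abs_base_le M u v (hdom ▸ hbd) fun z hz => (hcell z hz).2
  set Rv : ℝ := (∑ j, |(v.1 j : ℝ)|) * R + |(v.2 : ℝ)| with hRv
  have hvle : ∀ z : Fin (B + 1 + 1) → ℝ, (∀ j, 0 < affF B 1 (M j) z) → |affF B 1 v z| ≤ Rv :=
    fun z hz => abs_affF_le v (hRz z hz)
  -- the constant level
  obtain ⟨k, hk⟩ := exists_nat_ge Rv
  set K : (Fin (B + 1) → ℚ) × ℚ := (0, (k : ℚ) + 1) with hKdef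
  have hKz : ∀ z : Fin (B + 1 + 1) → ℝ, affF B 1 K z = (k : ℝ) + 1 := fun z => by
    simp [hKdef, affF]
  -- a rational thickness
  obtain ⟨δ', hδ'0, hδ'⟩ := exists_rat_btwn hδ0
  have hδ'q : (0 : ℚ) < δ' := by exact_mod_cast hδ'0
  have hk1 : (0 : ℚ) < 2 * ((k : ℚ) + 1) := by positivity
  have hk1' : (0 : ℝ) < 2 * ((k : ℝ) + 1) := by positivity
  set lam : ℚ := δ' / (2 * ((k : ℚ) + 1)) with hlam
  have hlamR : (lam : ℝ) = (δ' : ℝ) / (2 * ((k : ℝ) + 1)) := by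
    rw [hlam]; push_cast; ring
  refine good_parUp L e ℓ₁ ℓ₂ n₁ n₂ s M p u v K lam h12 hbd hdom hint rfl (div_pos hδ'q hk1)
    fun z hz => ?_
  obtain ⟨hu0, huv⟩ := hcell z hz
  have hv := hvle z hz
  have hd := hδ z hz
  rw [abs_le] at hv
  refine ⟨hu0, huv, ?_, ?_⟩
  · rw [hKz]; linarith
  · rw [hKz, hlamR]
    have h1 : (k : ℝ) + 1 - affF B 1 v z ≤ 2 * ((k : ℝ) + 1) := by linarith
    calc (δ' : ℝ) / (2 * ((k : ℝ) + 1)) * ((k : ℝ) + 1 - affF B 1 v z)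
        ≤ (δ' : ℝ) / (2 * ((k : ℝ) + 1)) * (2 * ((k : ℝ) + 1)) :=
          mul_le_mul_of_nonneg_left h1 (div_nonneg hδ'0.le hk1'.le)
      _ = δ' := div_mul_cancel₀ _ hk1'.ne'
      _ ≤ _ := by linarith

end ParThick

end RebasePos

/-- **Registered part of `stub_rebaseSimplePosOne`, residual hypothesis `Hpar` (line
`janus-bands`, v6.2): THICK bands.** One lettered fibre over a base of dimension `B + 1` with
letter `0`, affine bounds `0 < u < v` on the base cell (any slopes; in `Hpar` they are parallel in
`y`, so that the width `v − u` is `y`-free) and width bounded below on the base cell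
(`v − u ≥ δ > 0`): `[s]` is congruent modulo `KZ.relations` to the subgroup generated by the
literal class `GG B 2 1` (`RebasePos.good_parThick`: Janus extension of the upper bound up to a
constant level `K ≥ sup v`, rule 1a, the upper wedge `{v < t < K}` being dominated with constant
`1` through `t ↦ v − λ (K − t)`, `λ = δ'/(2K)`; both pieces land by one affine pull-back each,
rule 2). -/
theorem rebaseSimplePos_par_thick (B m m' n₁ n₂ : ℕ) (s : KZ.IntegralRep (B + 1 + 1)) (M : Fin m' → (Fin (B + 1) → ℚ) × ℚ) (L : Fin m → (Fin B → ℚ) × ℚ) (e : Fin m → ℕ) (p : MvPolynomial (Fin B) ℚ) (ℓ₁ ℓ₂ : (Fin B → ℚ) × ℚ) (u v : (Fin (B + 1) → ℚ) × ℚ) (h12 : n₁ = 0 ∨ n₂ = 0) (hbd : Bornology.IsBounded s.domain) (hdom : s.domain = SeparatePos.gDom B 1 m' M (fun _ => Sum.inr u) (fun _ => Sum.inr v)) (hint : EqOn s.integrand (RebasePos.glit B 1 p L e ℓ₁ ℓ₂ n₁ n₂ (fun _ => some 0)) s.domain) (hcell : ∀ z : Fin (B + 1 + 1) → ℝ, (∀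 j, 0 < SeparatePos.affF B 1 (M j) z) → 0 < SeparatePos.affF B 1 u z ∧ SeparatePos.affF B 1 u z < SeparatePos.affF B 1 v z) (hδ : ∃ δ : ℝ, 0 < δ ∧ ∀ z : Fin (B + 1 + 1) → ℝ, (∀ j, 0 < SeparatePos.affF B 1 (M j) z) → δ ≤ SeparatePos.affF B 1 v z - SeparatePos.affF B 1 u z) : ∃ c ∈ AddSubgroup.closure (SeparatePos.GGset B 2 1), KZ.of s - c ∈ KZ.relations :=
  RebasePos.good_parThick L e ℓ₁ ℓ₂ n₁ n₂ s M p u v h12 hbd hdom hint hcell hδ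

end Summit.KontsevichZagierPeriods.ArrangementNormalForm.JanusBands
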